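import Summits.QuantumFields.YangMills.Theorems.BalabanUVNodesPortS1LZdetPiecesBound
import Summits.QuantumFields.YangMills.Theorems.BalabanUVNodesPortS1LZdetGeom
import Literature.Analysis.Complex.LocallyUniformLimitSCV
import Literature.Analysis.Complex.HolomorphicParametricIntegral
import Literature.Analysis.Complex.OsgoodProofs

/-!
# NODE O port PT-A — ROW (a) OF THE GAUSSIAN BRACKET's LOCALIZED PIECES (v3.4 glue `stub_LZdetGlue` of 27930, line `pta_residueW`): `φ ↦ lzdetPiece … X φ` IS HOLOMORPHIC AT EVERY PAIR OF
# THE RECORD SPACE OF `X` — the resolvent member by holomorphy of dominated parameter integrals + Osgood on (g2)'s open set, the power member as a normally convergent series of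
# polynomials in the (analytic) carrier entries on a common neighbourhood where the Schur sums keep a factor-2 slack

Cell `ym-nodeO-ideate`, porter seat `ymgap-nodeO-port-PTA-1` (gen 8); `--supports stmt-QuantumFields-27930` (helper, P0-free).  [I] = [Balaban1987RG1], [16] = [Balaban1985UV3], [15] = [Balaban1985Variational].
* §1 (generic) `differentiableOn_prod_map_apply` ∕ `differentiableOn_trace_prod_map` ∕ `differentiableOn_locPowPiece` — entries of ordered products of entrywise-holomorphic matrix families, their traces, and the
  localized power pieces `locPowPiece` are holomorphic (entrywise calculus only: no norm on the matrix space enters).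
* §2 (generic) ★★ `analyticOnNhd_powMemberPiece` — on an open set where the pieces inside `X` are entrywise holomorphic and obey the operator-norm decay `c·e^{−δ d(Y)}` with
  `κ₀(4·2^d, 2d) ≤ δ∕2 − 1`, `R ≥ 2c(4·2^dK₀)e^δ`, the piece `powMemberPiece … X` is analytic (Weierstrass M-test form ✓`SCV.analyticOnNhd_tsum_of_summable_norm` with the termwise bound
  ✓`norm_term63_le` and the torus touching sum ✓`touchSum_torus_le`).
* §3 (generic) ★ `differentiableOn_intervalIntegral` — `φ ↦ ∫₀^R G(x, φ) dx` is holomorphic on an open set where `G(x, ·)` is holomorphic for `x ≥ 0`, x-uniformly bounded, and `G(·, φ)` is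
  continuous on `[0, ∞)` (✓`Literature.Analysis.Complex.differentiableOn_integral_of_dominated` on `volume|_(0,R]`).
* §4 (record) `norm_nonB0Block_le_of_schur` (Schur on the full index ⟹ `ℓ²`-operator norm of the non-b₀ block), ★★★ `analyticAt_lzdetGPiece` ∕ ★★★ `analyticAt_lzdetPiece` — row (a) of the
  residue for the (63) pieces at a pair `φ` with `encodeCfg φ ∈ recordUc … X`, from: the letter's (P4) (entrywise analyticity + Schur decay at the record spaces of the `Y ⊆ X`, reached from
  `recordUc … X` by ✓`recordUc_anti`), the cube-form support, and (g2)(g3)(g5) of the resolvent pieces on an open `O ⊇` the record space of `X`.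

HONEST FRAMING.  Complex-analytic bookkeeping over the tree's own objects; NOTHING of Bałaban's estimates asserted, ported or discharged — the inputs (P4), (g2)(g3)(g5) are the OPEN letters
`P0HolExtAtRecordGL` ∕ `G3CAtRecordL` (inhabited nowhere); `stub_P0C` ∕ `stub_G3C` ∕ `stub_LZdetGlue` ∕ `stub_FE` OPEN; 27930 OPEN (2∕6 stubs by name) · no claim; NODE O 0∕1; COUNT 8∕28 · K 1∕4 UNMOVED;
finite `𝕋⁴_{L^K}` at fixed ε — NOT continuum ∕ OS ∕ Clay; **the Yang–Mills mass gap is NOT proved by any of this.**  No `sorry`, no `def`, no `instance`, no `notation`; standard axioms.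
-/

noncomputable section

open scoped BigOperators Matrix.Norms.L2Operator Topology
open Finset MeasureTheory

namespace Summit.QuantumFields.YangMills.Theorems.BalabanUVNodesPortS1

open Summit.QuantumFields.YangMills.Theorems.K0RecordFormatNames
open Literature.MathematicalPhysics.QuantumFieldTheory.Balaban1983to89
open Literature.MathematicalPhysics.QuantumFieldTheory.Balaban1983to89.Node00
open Literature.MathematicalPhysics.QuantumFieldTheory.Balaban1983to89.T4Continuum (T4Family)
open Literature.MathematicalPhysics.QuantumFieldTheory.Balaban1983to89.TreeLengthTorus
open Literature.MathematicalPhysics.QuantumFieldTheory.Balaban1983to89.B12TreeDecay (K₀ kappa₀)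

/-! ## §1  Entrywise holomorphy of ordered products, traces and localized power pieces -/

section Generic

variable {E : Type*} [NormedAddCommGroup E] [NormedSpace ℂ E] {S : Type} [Fintype S] [DecidableEq S] {ι : Type}

/-- Entries of an ordered product of entrywise-holomorphic matrix families are holomorphic (induction on the list; `(AB)_{ab} = Σ_c A_{ac}B_{cb}`). [folklore] [cite: Balaban1985UV3, (63) p.272 (bookkeeping)] -/
theorem differentiableOn_prod_map_apply {O : Set E} (T : ι → E → Matrix S S ℂ) :
    ∀ (l : List ι), (∀ i ∈ l, ∀ a b : S, DifferentiableOn ℂ (fun φ => T i φ a b) O) →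
      ∀ a b : S, DifferentiableOn ℂ (fun φ => ((l.map fun i => T i φ).prod) a b) O
  | [], _, a, b => by
    simp only [List.map_nil, List.prod_nil]
    exact differentiableOn_const _
  | i :: l, hT, a, b => by
    have hi := hT i List.mem_cons_self
    have hl := differentiableOn_prod_map_apply T l (fun i' hi' => hT i' (List.mem_cons_of_mem _ hi'))
    simp only [List.map_cons, List.prod_cons, Matrix.mul_apply]
    exact DifferentiableOn.fun_sum fun c _ => (hi a c).mul (hl c b)

/-- The trace of an ordered product of entrywise-holomorphic matrix families is holomorphic. [folklore] [cite: Balaban1985UV3, (63) p.272 (bookkeeping)] -/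
theorem differentiableOn_trace_prod_map {O : Set E} (T : ι → E → Matrix S S ℂ) (l : List ι)
    (hT : ∀ i ∈ l, ∀ a b : S, DifferentiableOn ℂ (fun φ => T i φ a b) O) :
    DifferentiableOn ℂ (fun φ => Matrix.trace ((l.map fun i => T i φ).prod)) O := by
  simp only [Matrix.trace, Matrix.diag]
  exact DifferentiableOn.fun_sum fun a _ => differentiableOn_prod_map_apply T l hT a a

/-- **The localized power pieces of an entrywise-holomorphic family are holomorphic** (finite sums of traces of ordered products). [cite: Balaban1985UV3, (63) p.272; Balaban1987RG1, (1.18) p.263] -/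
theorem differentiableOn_locPowPiece [Fintype ι] [DecidableEq ι] {Q : Type} [DecidableEq Q] {O : Set E} (supp : ι → Finset Q) (T : ι → E → Matrix S S ℂ)
    (hT : ∀ i (a b : S), DifferentiableOn ℂ (fun φ => T i φ a b) O) (m : ℕ) (U : Finset Q) :
    DifferentiableOn ℂ (fun φ => locPowPiece supp (fun i => T i φ) m U) O := by
  unfold locPowPiece
  exact DifferentiableOn.fun_sum fun l _ => differentiableOn_trace_prod_map T l fun i _ => hT i

/-! ## §2  The power-member piece is analytic where the pieces inside `X` are holomorphic with operator-norm decay -/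

/-- ★★ **ANALYTICITY OF THE POWER PIECE ON AN OPEN SET**: entrywise holomorphy of the pieces `Y ⊆ X` on an open `O`, their operator-norm decay `c·e^{−δ d(Y)}` on `O`, cube-form supports, `κ₀(4·2^d, 2d) ≤ δ∕2 − 1`,
`0 < R`, `2c(4·2^dK₀)e^δ ≤ R` ⟹ `φ ↦ powMemberPiece … (Y ↦ T Y φ) R X` is analytic on `O` (the series of [16] (63) converges normally, term `j` bounded by `¼·N_X·#X·e^{−(δ∕2)d(X)}·2^{−j}`).
[cite: Balaban1985UV3, (63) p.272, (23)–(25) p.262; Balaban1987RG1, (1.18) p.263; Balaban1988RG2Cluster, (1.26) p.8] -/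
theorem analyticOnNhd_powMemberPiece [FiniteDimensional ℂ E] {d N : ℕ} [NeZero N] [DecidableEq (TDom d N)] (cube : S → TPt d N) {O : Set E} (hO : IsOpen O)
    (T : TDom d N → E → Matrix S S ℂ) {c δ R : ℝ} (hc : 0 ≤ c) (hδ : kappa₀ (4 * 2 ^ d) (2 * d) ≤ δ / 2 - 1) (hR : 0 < R)
    (hRc : 2 * (c * (4 * 2 ^ d * K₀ (4 * 2 ^ d) (2 * d)) * Real.exp δ) ≤ R)
    (hsupp : ∀ Y φ s s', (cube s ∉ (Y.1 : Finset (TPt d N)) ∨ cube s' ∉ (Y.1 : Finset (TPt d N))) → T Y φ s s' = 0)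
    (X : TDom d N)
    (hTd : ∀ Y : TDom d N, (Y.1 : Finset (TPt d N)) ⊆ X.1 → ∀ a b, DifferentiableOn ℂ (fun φ => T Y φ a b) O)
    (hTb : ∀ Y : TDom d N, (Y.1 : Finset (TPt d N)) ⊆ X.1 → ∀ φ ∈ O, ‖T Y φ‖ ≤ c * Real.exp (-(δ * torusTreeLen (Y.1 : Finset (TPt d N))))) :
    AnalyticOnNhd ℂ (fun φ => powMemberPiece (fun Y : TDom d N => (Y.1 : Finset (TPt d N))) (fun Y => T Y φ) R X.1) O := by
  classical
  set T' : TDom d N → E → Matrix S S ℂ := fun Y φ => if (Y.1 : Finset (TPt d N)) ⊆ X.1 then T Y φ else 0 with hT'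
  have heq : (fun φ => powMemberPiece (fun Y : TDom d N => (Y.1 : Finset (TPt d N))) (fun Y => T Y φ) R X.1) =
      fun φ => ∑' j : ℕ, (coef63 R j : ℂ) * locPowPiece (fun Y : TDom d N => (Y.1 : Finset (TPt d N))) (fun Y => T' Y φ) (j + 1) X.1 := by
    funext φ
    rw [powMemberPiece_restrict]
    rfl
  rw [heq]
  have hδ0 : 0 ≤ δ := by
    have := B12TreeDecay.kappa₀_nonneg (by positivity : (0 : ℝ) ≤ 4 * 2 ^ d) (2 * d); linarith
  have hKc : 0 ≤ 4 * 2 ^ d * K₀ (4 * 2 ^ d) (2 * d) := by have := B12TreeDecay.K₀_pos (4 * 2 ^ d) (2 * d); positivity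
  have hsupp' : ∀ φ Y s s', (cube s ∉ (Y.1 : Finset (TPt d N)) ∨ cube s' ∉ (Y.1 : Finset (TPt d N))) → T' Y φ s s' = 0 := by
    intro φ Y s s' h; simp only [hT']; split_ifs
    · exact hsupp Y φ s s' h
    · rfl
  have hT'd : ∀ Y (a b : S), DifferentiableOn ℂ (fun φ => T' Y φ a b) O := by
    intro Y a b
    by_cases hY : (Y.1 : Finset (TPt d N)) ⊆ X.1
    · simp only [hT', if_pos hY]; exact hTd Y hY a b
    · simp only [hT', if_neg hY]; exact differentiableOn_const _
  have hT'b : ∀ φ ∈ O, ∀ Y : TDom d N, ‖T' Y φ‖ ≤ c * Real.exp (-(δ * torusTreeLen (Y.1 : Finset (TPt d N)))) := by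
    intro φ hφ Y; simp only [hT']; split_ifs with h
    · exact hTb Y h φ hφ
    · rw [norm_zero]; positivity
  refine Literature.Analysis.Complex.SCV.analyticOnNhd_tsum_of_summable_norm hO
    (fun j => (differentiableOn_const _).mul (differentiableOn_locPowPiece _ T' hT'd (j + 1) X.1))
    (u := fun j : ℕ => (1 / 4) * (((univ.filter fun s : S => cube s ∈ (X.1 : Finset (TPt d N))).card : ℝ) * (X.1 : Finset (TPt d N)).card *
      Real.exp (-(δ / 2 * torusTreeLen (X.1 : Finset (TPt d N))))) * (1 / 2) ^ j)
    ((summable_geometric_of_lt_one (by norm_num) (by norm_num : (1 / 2 : ℝ) < 1)).mul_left _) fun j φ hφ => ?_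
  exact norm_term63_le (cube := cube) (supp := fun Y : TDom d N => (Y.1 : Finset (TPt d N))) (T := fun Y => T' Y φ) (fun Y => Y.2)
    (hsupp' φ) hc hδ0 hKc hR hRc (hT'b φ hφ) (fun Y => touchSum_torus_le (d := d) (N := N) hδ Y) X.1 X.2.1 j

/-! ## §3  Holomorphy of `φ ↦ ∫₀^R G(x, φ) dx` -/

/-- ★ **HOLOMORPHY OF THE x-INTEGRAL OF THE RESOLVENT MEMBER**: on an open `O`, if `G(x, ·)` is holomorphic for every `x ≥ 0`, `‖G(x, φ)‖ ≤ B` for `x ≥ 0`, `φ ∈ O`, and `G(·, φ)` is continuous on `[0, ∞)` for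
`φ ∈ O`, then `φ ↦ ∫₀^R G(x, φ) dx` (`R ≥ 0`) is holomorphic on `O` (dominated parameter integral on the finite measure `volume|_(0,R]`). [folklore] [cite: Balaban1985UV3, (63) p.272 (the x-integral)] -/
theorem differentiableOn_intervalIntegral {O : Set E} (hO : IsOpen O) (G : ℝ → E → ℂ) {R B : ℝ} (hR : 0 ≤ R)
    (hGd : ∀ x : ℝ, 0 ≤ x → DifferentiableOn ℂ (G x) O) (hGb : ∀ x : ℝ, 0 ≤ x → ∀ φ ∈ O, ‖G x φ‖ ≤ B)
    (hGc : ∀ φ ∈ O, ContinuousOn (fun x : ℝ => G x φ) (Set.Ici 0)) :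
    DifferentiableOn ℂ (fun φ => ∫ x in (0 : ℝ)..R, G x φ) O := by
  have heq : (fun φ => ∫ x in (0 : ℝ)..R, G x φ) = fun φ => ∫ x in Set.Ioc 0 R, G x φ := by
    funext φ; rw [intervalIntegral.integral_of_le hR]
  rw [heq]
  have hsub : Set.Ioc (0 : ℝ) R ⊆ Set.Ici 0 := fun x hx => le_of_lt hx.1
  refine Literature.Analysis.Complex.differentiableOn_integral_of_dominated (μ := volume.restrict (Set.Ioc 0 R)) (F := fun φ x => G x φ)
    (fun φ hφ => ((hGc φ hφ).mono hsub).aestronglyMeasurable measurableSet_Ioc) ?_ fun φ₀ hφ₀ => ?_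
  · exact (ae_restrict_iff' measurableSet_Ioc).2 (Filter.Eventually.of_forall fun x hx => hGd x (le_of_lt hx.1))
  · obtain ⟨r, hr, hball⟩ := Metric.isOpen_iff.1 hO φ₀ hφ₀
    refine ⟨r, hr, hball, fun _ => B, ?_, ?_⟩
    · exact integrableOn_const (measure_Ioc_lt_top.ne)
    · exact (ae_restrict_iff' measurableSet_Ioc).2 (Filter.Eventually.of_forall fun x hx φ hφ => hGb x (le_of_lt hx.1) φ (hball hφ))

end Generic

/-! ## §4  At the record: row (a) of the Gaussian bracket's pieces -/

section Record

variable (F : T4Family)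

/-- Schur row∕column bounds on the FULL fluctuation index give the `ℓ²`-operator norm of the non-b₀ block (sub-sums of non-negative terms). [cite: Balaban1987RG1, (2.11) p.267 (bookkeeping)] -/
theorem norm_nonB0Block_le_of_schur (k K : ℕ) (A : FluctIdx F k K → FluctIdx F k K → ℂ) {M : ℝ} (hM : 0 ≤ M)
    (hrow : ∀ i, ∑ j, ‖A i j‖ ≤ M) (hcol : ∀ j, ∑ i, ‖A i j‖ ≤ M) : ‖nonB0Block F k K A‖ ≤ M := by
  classical
  have hsub : ∀ f : FluctIdx F k K → ℝ, (∀ l, 0 ≤ f l) → ∑ l : NonB0Idx F k K, f l.1 ≤ ∑ l, f l := by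
    intro f hf
    rw [← Finset.sum_subtype (univ.filter fun i : FluctIdx F k K => i.1 ∉ Set.range (recordB0 F k K)) (by simp) f]
    exact Finset.sum_le_univ_sum_of_nonneg hf
  refine l2_opNorm_le_of_row_col_sum _ hM (fun i => ?_) (fun j => ?_)
  · calc ∑ j : NonB0Idx F k K, ‖nonB0Block F k K A i j‖ = ∑ j : NonB0Idx F k K, ‖A i.1 j.1‖ := rfl
      _ ≤ ∑ j, ‖A i.1 j‖ := hsub (fun j => ‖A i.1 j‖) fun _ => norm_nonneg _
      _ ≤ M := hrow i.1
  · calc ∑ i : NonB0Idx F k K, ‖nonB0Block F k K A i j‖ = ∑ i : NonB0Idx F k K, ‖A i.1 j.1‖ := rfl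
      _ ≤ ∑ i, ‖A i j.1‖ := hsub (fun i => ‖A i j.1‖) fun _ => norm_nonneg _
      _ ≤ M := hcol j.1

open scoped Classical in
/-- ★★★ **ROW (a) FOR THE UNSUBTRACTED PIECE**: `φ ↦ G_X(φ) = ½∫₀^R EG(x, X, φ)dx + powMemberPiece_X(φ)` is ℂ-ANALYTIC AT every pair `φ` with `encodeCfg φ ∈ recordUc … X`, given: the resolvent pieces'
(g2)(g3)(g5) on an open `O ⊇` the record space of `X` (holomorphy for `x ≥ 0`, an x-uniform bound, continuity in `x` on `[0, ∞)`); the carrier pieces' (P4) at the record spaces of every `Y`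
(entrywise analyticity + Schur row∕column decay `c₀e^{−δ₀ d(Y)}`); cube-form supports; `κ₀(4·2^d,2d) ≤ δ₀∕2 − 1`, `0 < R`, and the DOUBLED radius condition `2·(2c₀)·(4·2^dK₀)e^{δ₀} ≤ R` (a
neighbourhood of `φ` where every Schur sum keeps a factor-2 slack is produced by continuity; `U^c(X) ⊆ U^c(Y)` for `Y ⊆ X` by ✓`recordUc_anti`).
[cite: Balaban1985UV3, (63) p.272, (23)–(25) p.262; Balaban1987RG1, (1.18) p.263, (1.11)–(1.16) p.262; Balaban1985Variational, Prop. 9 p.309] -/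
theorem analyticAt_lzdetGPiece (Mc k K : ℕ)
    (TYK : (recordDomSys F Mc k K).Dom → Sect2.CPair (F.P K) (MatA 2) → FluctIdx F k K → FluctIdx F k K → ℂ)
    (EGK : ℝ → (recordDomSys F Mc k K).Dom → Sect2.CPair (F.P K) (MatA 2) → ℂ)
    (cube : NonB0Idx F k K → TPt (F.P K).d (Sect2.domCount (F.P K) Mc (k + 1)))
    {α₀ α₁ R c₀ δ₀ B : ℝ} (hR : 0 < R) (hc₀ : 0 < c₀)
    (hδ : kappa₀ (4 * 2 ^ (F.P K).d) (2 * (F.P K).d) ≤ δ₀ / 2 - 1)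
    (hRc : 2 * ((2 * c₀) * (4 * 2 ^ (F.P K).d * K₀ (4 * 2 ^ (F.P K).d) (2 * (F.P K).d)) * Real.exp δ₀) ≤ R)
    (hsupp : ∀ Y φ (s s' : NonB0Idx F k K),
      (cube s ∉ (Y.1 : Finset (TPt (F.P K).d (Sect2.domCount (F.P K) Mc (k + 1)))) ∨ cube s' ∉ (Y.1 : Finset (TPt (F.P K).d (Sect2.domCount (F.P K) Mc (k + 1))))) →
        TYK Y φ s.1 s'.1 = 0)
    (X : (recordDomSys F Mc k K).Dom) {O : Set (Sect2.CPair (F.P K) (MatA 2))} (hO : IsOpen O)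
    (hOX : ∀ φ, encodeCfg F K φ ∈ recordUc F Mc k α₀ α₁ K X → φ ∈ O)
    (hEGd : ∀ x : ℝ, 0 ≤ x → DifferentiableOn ℂ (fun φ => EGK x X φ) O) (hEGb : ∀ x : ℝ, 0 ≤ x → ∀ φ ∈ O, ‖EGK x X φ‖ ≤ B)
    (hEGc : ∀ φ ∈ O, ContinuousOn (fun x : ℝ => EGK x X φ) (Set.Ici 0))
    (hTYa : ∀ (Y : (recordDomSys F Mc k K).Dom) φ, encodeCfg F K φ ∈ recordUc F Mc k α₀ α₁ K Y →
      ∀ i j : FluctIdx F k K, AnalyticAt ℂ (fun ψ => TYK Y ψ i j) φ)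
    (hTYr : ∀ (Y : (recordDomSys F Mc k K).Dom) φ, encodeCfg F K φ ∈ recordUc F Mc k α₀ α₁ K Y →
      ∀ i : FluctIdx F k K, ∑ j, ‖TYK Y φ i j‖ ≤ c₀ * Real.exp (-(δ₀ * (recordDomSys F Mc k K).dj Y)))
    (hTYc : ∀ (Y : (recordDomSys F Mc k K).Dom) φ, encodeCfg F K φ ∈ recordUc F Mc k α₀ α₁ K Y →
      ∀ j : FluctIdx F k K, ∑ i, ‖TYK Y φ i j‖ ≤ c₀ * Real.exp (-(δ₀ * (recordDomSys F Mc k K).dj Y)))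
    (φ : Sect2.CPair (F.P K) (MatA 2)) (hφ : encodeCfg F K φ ∈ recordUc F Mc k α₀ α₁ K X) :
    AnalyticAt ℂ (lzdetGPiece F Mc k K TYK EGK R X) φ := by
  have hdj : ∀ Y : (recordDomSys F Mc k K).Dom, (recordDomSys F Mc k K).dj Y = torusTreeLen (Y.1 : Finset (TPt (F.P K).d (Sect2.domCount (F.P K) Mc (k + 1)))) := fun _ => rfl
  -- membership in the record spaces of the sub-domains
  have hφY : ∀ Y : (recordDomSys F Mc k K).Dom, (Y.1 : Finset _) ⊆ X.1 → encodeCfg F K φ ∈ recordUc F Mc k α₀ α₁ K Y :=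
    fun Y hY => recordUc_anti F Mc k α₀ α₁ K hY hφ
  -- (1) a neighbourhood of φ on which every entry of every piece inside X is analytic and every Schur sum keeps a factor-2 slack
  set ε : (recordDomSys F Mc k K).Dom → ℝ := fun Y => c₀ * Real.exp (-(δ₀ * (recordDomSys F Mc k K).dj Y)) / ((Fintype.card (FluctIdx F k K) : ℝ) + 1) with hε
  have hεpos : ∀ Y, 0 < ε Y := fun Y => by positivity
  have hA : ∀ᶠ ψ in 𝓝 φ, ∀ Y : (recordDomSys F Mc k K).Dom, (Y.1 : Finset _) ⊆ X.1 → ∀ i j : FluctIdx F k K, AnalyticAt ℂ (fun ψ' => TYK Y ψ' i j) ψ := by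
    refine Filter.eventually_all.2 fun Y => ?_
    by_cases hY : (Y.1 : Finset _) ⊆ X.1
    · have h := Filter.eventually_all.2 fun i : FluctIdx F k K => Filter.eventually_all.2 fun j : FluctIdx F k K => (hTYa Y φ (hφY Y hY) i j).eventually_analyticAt
      filter_upwards [h] with ψ hψ _ i j using hψ i j
    · exact Filter.Eventually.of_forall fun ψ h => (hY h).elim
  have hB : ∀ᶠ ψ in 𝓝 φ, ∀ Y : (recordDomSys F Mc k K).Dom, (Y.1 : Finset _) ⊆ X.1 → ∀ i j : FluctIdx F k K, ‖TYK Y ψ i j‖ ≤ ‖TYK Y φ i j‖ + ε Y := by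
    refine Filter.eventually_all.2 fun Y => ?_
    by_cases hY : (Y.1 : Finset _) ⊆ X.1
    · have h := Filter.eventually_all.2 fun i : FluctIdx F k K => Filter.eventually_all.2 fun j : FluctIdx F k K =>
        Filter.Tendsto.eventually_lt_const (lt_add_of_pos_right _ (hεpos Y)) ((hTYa Y φ (hφY Y hY) i j).continuousAt.norm.tendsto)
      filter_upwards [h] with ψ hψ _ i j using (hψ i j).le
    · exact Filter.Eventually.of_forall fun ψ h => (hY h).elim
  obtain ⟨Oφ, hOφsub, hOφopen, hφOφ⟩ := mem_nhds_iff.1 (hA.and hB)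
  -- the working open set
  set O' : Set (Sect2.CPair (F.P K) (MatA 2)) := O ∩ Oφ with hO'def
  have hO' : IsOpen O' := hO.inter hOφopen
  have hφO' : φ ∈ O' := ⟨hOX φ hφ, hφOφ⟩
  -- (2) the pieces as non-b₀ blocks: entrywise holomorphic on O', operator norm ≤ 2c₀e^{-δ₀ d(Y)} there
  set T : (recordDomSys F Mc k K).Dom → Sect2.CPair (F.P K) (MatA 2) → Matrix (NonB0Idx F k K) (NonB0Idx F k K) ℂ :=
    fun Y ψ => nonB0Block F k K (TYK Y ψ) with hT
  have hTd : ∀ Y : (recordDomSys F Mc k K).Dom, (Y.1 : Finset _) ⊆ X.1 → ∀ a b : NonB0Idx F k K, DifferentiableOn ℂ (fun ψ => T Y ψ a b) O' := by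
    intro Y hY a b ψ hψ
    exact ((hOφsub hψ.2).1 Y hY a.1 b.1).differentiableAt.differentiableWithinAt
  have hTb : ∀ Y : (recordDomSys F Mc k K).Dom, (Y.1 : Finset _) ⊆ X.1 → ∀ ψ ∈ O',
      ‖T Y ψ‖ ≤ (2 * c₀) * Real.exp (-(δ₀ * torusTreeLen (Y.1 : Finset (TPt (F.P K).d (Sect2.domCount (F.P K) Mc (k + 1)))))) := by
    intro Y hY ψ hψ
    have hb := (hOφsub hψ.2).2 Y hY
    rw [← hdj]
    have hce : 0 ≤ c₀ * Real.exp (-(δ₀ * (recordDomSys F Mc k K).dj Y)) := by positivity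
    have hcard : (Fintype.card (FluctIdx F k K) : ℝ) * ε Y ≤ c₀ * Real.exp (-(δ₀ * (recordDomSys F Mc k K).dj Y)) := by
      simp only [hε]
      rw [mul_div_assoc', div_le_iff₀ (by positivity)]
      nlinarith
    refine norm_nonB0Block_le_of_schur F k K (TYK Y ψ) (by positivity) (fun i => ?_) (fun j => ?_)
    · calc ∑ j, ‖TYK Y ψ i j‖ ≤ ∑ j, (‖TYK Y φ i j‖ + ε Y) := Finset.sum_le_sum fun j _ => hb i j
        _ = ∑ j, ‖TYK Y φ i j‖ + (Fintype.card (FluctIdx F k K) : ℝ) * ε Y := by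
            rw [Finset.sum_add_distrib, Finset.sum_const, Finset.card_univ, nsmul_eq_mul]
        _ ≤ c₀ * Real.exp (-(δ₀ * (recordDomSys F Mc k K).dj Y)) + c₀ * Real.exp (-(δ₀ * (recordDomSys F Mc k K).dj Y)) :=
            add_le_add (hTYr Y φ (hφY Y hY) i) hcard
        _ = (2 * c₀) * Real.exp (-(δ₀ * (recordDomSys F Mc k K).dj Y)) := by ring
    · calc ∑ i, ‖TYK Y ψ i j‖ ≤ ∑ i, (‖TYK Y φ i j‖ + ε Y) := Finset.sum_le_sum fun i _ => hb i j
        _ = ∑ i, ‖TYK Y φ i j‖ + (Fintype.card (FluctIdx F k K) : ℝ) * ε Y := by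
            rw [Finset.sum_add_distrib, Finset.sum_const, Finset.card_univ, nsmul_eq_mul]
        _ ≤ c₀ * Real.exp (-(δ₀ * (recordDomSys F Mc k K).dj Y)) + c₀ * Real.exp (-(δ₀ * (recordDomSys F Mc k K).dj Y)) :=
            add_le_add (hTYc Y φ (hφY Y hY) j) hcard
        _ = (2 * c₀) * Real.exp (-(δ₀ * (recordDomSys F Mc k K).dj Y)) := by ring
  -- (3) the power member is analytic on O'
  have hpow := analyticOnNhd_powMemberPiece (E := Sect2.CPair (F.P K) (MatA 2)) cube hO' T (c := 2 * c₀) (by positivity) hδ hR hRc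
    (fun Y ψ s s' h => by simp only [hT, nonB0Block, Matrix.of_apply]; exact hsupp Y ψ s s' h) X hTd hTb
  -- (4) the resolvent member is holomorphic on O'
  have hint : DifferentiableOn ℂ (fun ψ => ∫ x in (0 : ℝ)..R, EGK x X ψ) O' :=
    differentiableOn_intervalIntegral hO' (fun x ψ => EGK x X ψ) hR.le (fun x hx => (hEGd x hx).mono Set.inter_subset_left)
      (fun x hx ψ hψ => hEGb x hx ψ hψ.1) (fun ψ hψ => hEGc ψ hψ.1)
  have hintA : AnalyticAt ℂ (fun ψ => ∫ x in (0 : ℝ)..R, EGK x X ψ) φ :=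
    Literature.Analysis.Complex.SCV.analyticAt_of_differentiableOn hint hO' hφO'
  -- assemble
  have e : lzdetGPiece F Mc k K TYK EGK R X = fun ψ => (1 / 2 : ℂ) * (∫ x in (0 : ℝ)..R, EGK x X ψ) +
      powMemberPiece (fun Y : (recordDomSys F Mc k K).Dom => (Y.1 : Finset (TPt (F.P K).d (Sect2.domCount (F.P K) Mc (k + 1))))) (fun Y => T Y ψ) R X.1 := rfl
  rw [e]
  exact (analyticAt_const.mul hintA).add (hpow φ hφO')

open scoped Classical in
/-- ★★★ **ROW (a) FOR THE SUBTRACTED PIECE** `E_X(φ) = G_X(φ) − G_X(𝟙)` (the subtrahend is a constant). [cite: Balaban1987RG1, (1.18) p.263, (2.12)–(2.14) p.268; Balaban1985UV3, (63) p.272] -/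
theorem analyticAt_lzdetPiece (Mc k K : ℕ)
    (TYK : (recordDomSys F Mc k K).Dom → Sect2.CPair (F.P K) (MatA 2) → FluctIdx F k K → FluctIdx F k K → ℂ)
    (EGK : ℝ → (recordDomSys F Mc k K).Dom → Sect2.CPair (F.P K) (MatA 2) → ℂ)
    (cube : NonB0Idx F k K → TPt (F.P K).d (Sect2.domCount (F.P K) Mc (k + 1)))
    {α₀ α₁ R c₀ δ₀ B : ℝ} (hR : 0 < R) (hc₀ : 0 < c₀)
    (hδ : kappa₀ (4 * 2 ^ (F.P K).d) (2 * (F.P K).d) ≤ δ₀ / 2 - 1)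
    (hRc : 2 * ((2 * c₀) * (4 * 2 ^ (F.P K).d * K₀ (4 * 2 ^ (F.P K).d) (2 * (F.P K).d)) * Real.exp δ₀) ≤ R)
    (hsupp : ∀ Y φ (s s' : NonB0Idx F k K),
      (cube s ∉ (Y.1 : Finset (TPt (F.P K).d (Sect2.domCount (F.P K) Mc (k + 1)))) ∨ cube s' ∉ (Y.1 : Finset (TPt (F.P K).d (Sect2.domCount (F.P K) Mc (k + 1))))) →
        TYK Y φ s.1 s'.1 = 0)
    (X : (recordDomSys F Mc k K).Dom) {O : Set (Sect2.CPair (F.P K) (MatA 2))} (hO : IsOpen O)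
    (hOX : ∀ φ, encodeCfg F K φ ∈ recordUc F Mc k α₀ α₁ K X → φ ∈ O)
    (hEGd : ∀ x : ℝ, 0 ≤ x → DifferentiableOn ℂ (fun φ => EGK x X φ) O) (hEGb : ∀ x : ℝ, 0 ≤ x → ∀ φ ∈ O, ‖EGK x X φ‖ ≤ B)
    (hEGc : ∀ φ ∈ O, ContinuousOn (fun x : ℝ => EGK x X φ) (Set.Ici 0))
    (hTYa : ∀ (Y : (recordDomSys F Mc k K).Dom) φ, encodeCfg F K φ ∈ recordUc F Mc k α₀ α₁ K Y →
      ∀ i j : FluctIdx F k K, AnalyticAt ℂ (fun ψ => TYK Y ψ i j) φ)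
    (hTYr : ∀ (Y : (recordDomSys F Mc k K).Dom) φ, encodeCfg F K φ ∈ recordUc F Mc k α₀ α₁ K Y →
      ∀ i : FluctIdx F k K, ∑ j, ‖TYK Y φ i j‖ ≤ c₀ * Real.exp (-(δ₀ * (recordDomSys F Mc k K).dj Y)))
    (hTYc : ∀ (Y : (recordDomSys F Mc k K).Dom) φ, encodeCfg F K φ ∈ recordUc F Mc k α₀ α₁ K Y →
      ∀ j : FluctIdx F k K, ∑ i, ‖TYK Y φ i j‖ ≤ c₀ * Real.exp (-(δ₀ * (recordDomSys F Mc k K).dj Y)))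
    (φ : Sect2.CPair (F.P K) (MatA 2)) (hφ : encodeCfg F K φ ∈ recordUc F Mc k α₀ α₁ K X) :
    AnalyticAt ℂ (lzdetPiece F Mc k K TYK EGK R X) φ := by
  have h := analyticAt_lzdetGPiece F Mc k K TYK EGK cube hR hc₀ hδ hRc hsupp X hO hOX hEGd hEGb hEGc hTYa hTYr hTYc φ hφ
  have e : lzdetPiece F Mc k K TYK EGK R X = fun ψ => lzdetGPiece F Mc k K TYK EGK R X ψ - lzdetGPiece F Mc k K TYK EGK R X (unitCPair F K) := rfl
  rw [e]
  exact h.sub analyticAt_const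

end Record

end Summit.QuantumFields.YangMills.Theorems.BalabanUVNodesPortS1

end
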